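import Summits.BirchSwinnertonDyer.Rank1Residual.Additive.StrictSelmerDominatesSha
import Summits.BirchSwinnertonDyer.Rank1Residual.Additive.StrictSelmerIndexLocal
import Summits.BirchSwinnertonDyer.Rank1Residual.Additive.QuadraticBranchOddStrictExactControl
import Mathlib.Data.ZMod.QuotientGroup
import HarnessLib

/-!
# (P4♯) `Additive.StrictSelmerIndexAt` DISCHARGED: in rank one, `#Sel_str(E/ℚ)[p^∞] = pⁿ · #Ш(E/ℚ)[p^∞]`
# with `n = ν` the `p`-divisibility level of the generator in `E(ℚ_p)` — UNCONDITIONAL, every `E/ℚ`,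
# every prime `p` (cell `b2b-bsdres`, lane CLASS-CLOSURE, O10 class lead x1b GEN 30; cc-typer-6's
# ELEMENTARY typed input p307042 §3 `QuadraticBranchOddStrictExactControl.lean`, "a prover target
# (P4♯), size S–M over `StrictSelmerDominatesShaAlgebra`"; sequel of n1011-p01's (P4) discharge
# p263184 / p263878 `StrictSelmerDominatesSha(Algebra).lean`)

HONEST FRAMING (cell `b2b-bsdres`, run/shared/lean/b2b/bsd-rank1-residual/, verbatim in every
file): prove what is provable now; shrink each hard class to its core with data; no claim beyond
stated classes. Research routes; census output = EVIDENCE / conjecture items, never a Literature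
fact; RESIDUAL-MAP marks change only by signed lines; nothing is booked; no label changes. This file
is ELEMENTARY ALGEBRA + Galois-cohomology bookkeeping over the tree's `p^∞` Kummer theory
(`SelmerCorankProofs`, `StrictSelmerRankOne`, `StrictSelmerDominatesSha`); THEOREMS ONLY — NO
definition, NO Literature fact, NO `sorry`; `#print axioms` standard. It closes a TYPED INPUT of the
odd-`η`-branch consumer "(C1_η) ∧ (C2_η-GZ) ∧ (C3_η) (+ the index) ⟹ `BSD(W, p)`" (p307042 §4), which
therefore now reads "(C1_η) ∧ (C2_η-GZ) ∧ (C3_η) ⟹ `BSD(W, p)`" (§5); the three remaining inputs are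
typed `@[conjecture]`s and the classes served (O10-PS, O7-ss ∩ `e = 2`, O5a) stay OPEN /
CONSTRUCTION-SHAPED.

## Statement (p307042 §3, verbatim)
`StrictSelmerIndexAt W p := ∀ P n, ¬ IsOfFinAddOrder P → (P generates E(ℚ) mod torsion) →
(E(ℚ_p) has no point of order p) → (∃ Q, pⁿ Q = P in E(ℚ_p)) → (∀ Q, pⁿ⁺¹ Q ≠ P) →
Nat.card (strictSelmerPInfty W p) = p ^ n * Nat.card (Ш(W)[p^∞])`,
`strictSelmerPInfty W p = W.selmerGroupPInfty p ⊓ selmerLocalKerPrimaryTorsion W ℚ_[p] p`.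
**`strictSelmerIndexAt_holds : Additive.StrictSelmerIndexAt W p`** (§4).

## Proof (Greenberg LNM 1716 §2: the snake lemma on `Sel_{p^∞}(E/ℚ) → E(ℚ_p) ⊗ ℚ_p/ℤ_p`, explicit)
* `S₀ := Sel_{p^∞} ⊓ strict ↠ Ш[p^∞]` under `H¹(ℚ, E[p^∞]) → H¹(ℚ, E)` (n1011-p01's core
  `exists_sub_kummerMapLevel_mem_selmerLocalKerPrimaryTorsion`, re-assembled), so
  `#S₀ = #Ш[p^∞] · #ker` (`AddSubgroup.card_eq_card_quotient_mul_card_addSubgroup`).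
* The kernel = the STRICT Kummer classes = `{κ_n(a·P) : a ∈ ℤ}`: `⊇` by §1 of
  `StrictSelmerIndexLocal.lean` (`P = p^N R` in `E(E)` ⟹ `κ_N(P)` dies in `H¹(E, E(Ē)[p^∞])`); `⊆` by
  the tree's `exists_eq_nsmul_add_of_res_kummerMapLevel_eq_zero` + the valuation lemma §2 there
  (exact level `n` of `P` and no `p`-torsion in `E(E)` force `k·P ∈ p^N E(E) + tors ⟹ N ≤ n + v_p(k)`)
  + `kummerMapLevel_level` (every strict `κ_N(k·P)` has level `n`).
* `a ↦ κ_n(a·P)` has kernel EXACTLY `pⁿℤ` (`exists_of_kummerMapLevel_eq_zero` + `P` of infinite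
  order; `kummerMapLevel_nsmul_self`), so `ker ≅ ℤ/pⁿ` (`Int.quotientZMultiplesNatEquivZMod`,
  `Nat.card_zmod`).
* §3 = the count over any number field `K` / perfect `K`-field `E` with such a `λ` and the transport
  `hloc`; §4 = `K = ℚ`, `E = ℚ_[p]` (+ existence of the level, and the hypothesis-light corollary for
  every rank-one `E/ℚ` with `E(ℚ_p)[p] = 0`); §5 = p307042's two consumers, index hypothesis discharged.

Design: the general form §3 is elaborated with the classical `DecidableEq K` on `E(K)`; over `ℚ` the
typed statement carries `instDecidableEqRat`; §4 bridges the (subsingleton) instance gap with `convert`.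
Not here: the local RECIPE of (C3_η) — still the typed MISSING INPUT
`QuadraticBranchOddStrictExactControlOfPlusMCAt`; nor any O10 route (RULING a8bd8e04d6a47657).

References: [GreenbergLNM1716] §2 (pp. 62–63: Kummer theory, `E(F) ⊗ ℚ_p/ℤ_p`, the local Kummer
map); [KuriharaPollack2007] §1.5 (p. 361: fine/strict Selmer groups, the index of the generator);
[SilvermanAEC2009] Prop. VII.6.3, VIII.§1–2, X.§4; [SerreGaloisCohomology1997] I.§2.4, II.§1.1;
[Skinner2020] §2.2 (the rank-one strict Selmer group).
-/

universe u

noncomputable section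

open scoped Classical

open WeierstrassCurve Literature.NumberTheory.EllipticCurves Literature.NumberTheory.GaloisRepresentations

namespace Summit.BirchSwinnertonDyer.Rank1Residual.Additive.StrictSha

/-! ### §3 The index theorem over a number field (§1–§2 = `StrictSelmerIndexLocal.lean`) -/

/-- **`#(Sel_{p^∞}(E/K) ∩ Sel_str at E) = p^n · #Ш(E/K)[p^∞]` in rank one — general form.** For an
elliptic curve `E` over a number field `K`, a prime `p`, a perfect `K`-field `E` (a completion) with
`λ : E(E) → ℤ_p` (kernel = torsion, `p^b ℤ_p ⊆ im λ`) and NO point of order `p` in `E(E)`, IF every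
`Sel_{p^∞}` class satisfies the local Kummer condition at `E` (`hloc`, the transport hypothesis of
`card_primaryComponent_sha_dvd_card_strictSelmer_of_hom`) and `E(K) = ℤ·P + E(K)_tors` with `P` of
infinite order whose image in `E(E)` is divisible by `p^n` and not by `p^(n+1)`, THEN
`Nat.card (Sel_{p^∞} ⊓ strict) = p^n · Nat.card Ш(E/K)[p^∞]` (`Nat.card = 0` on both sides when
`Ш[p^∞]` is infinite). Proof: `S₀ ↠ Ш[p^∞]` (core of `StrictSelmerDominatesSha`) with kernel the
STRICT Kummer classes `= {κ_n(a·P) : a ∈ ℤ}` (§1 for `⊇`; `exists_eq_nsmul_add_of_res_kummerMapLevel_eq_zero`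
+ §2 for `⊆`), and `a ↦ κ_n(a·P)` has kernel exactly `p^n ℤ` (`exists_of_kummerMapLevel_eq_zero`,
`kummerMapLevel_nsmul_self`), so the kernel is `≅ ℤ/p^n`. Greenberg LNM 1716 §2 pp. 62–63;
Kurihara–Pollack 2007 §1.5. [cite: GreenbergLNM1716, §2 (pp. 62–63)]
[cite: KuriharaPollack2007, §1.5 (p. 361)] [cite: SilvermanAEC2009, Prop. VII.6.3] -/
theorem card_strictSelmer_eq_pow_mul_card_sha_of_hom {K : Type u} [Field K] [NumberField K]
    (W : WeierstrassCurve K) [W.IsElliptic] (p : ℕ) [Fact p.Prime]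
    (E : Type u) [Field E] [Algebra K E] [PerfectField E]
    (lam : (W.baseChange E).toAffine.Point →+ ℤ_[p]) {b : ℕ}
    (hlam : ∀ X, lam X = 0 ↔ IsOfFinAddOrder X)
    (hlamb : ∀ z : ℤ_[p], ∃ Y, lam Y = (p : ℤ_[p]) ^ b * z)
    (hloc : W.selmerGroupPInfty p ≤ selmerLocalKerPrimary W E p)
    (hnoTors : ∀ X : (W.baseChange E).toAffine.Point, p • X = 0 → X = 0)
    {P : W.toAffine.Point} {n : ℕ} (hP : ¬ IsOfFinAddOrder P)
    (hgen : ∀ R : W.toAffine.Point, ∃ (k : ℤ) (T : W.toAffine.Point),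
      IsOfFinAddOrder T ∧ R = k • P + T)
    (hdivP : ∃ Q : (W.baseChange E).toAffine.Point,
      p ^ n • Q = Affine.Point.baseChange (W' := W) K E P)
    (hndiv : ∀ Q : (W.baseChange E).toAffine.Point,
      p ^ (n + 1) • Q ≠ Affine.Point.baseChange (W' := W) K E P) :
    Nat.card ↥(W.selmerGroupPInfty p ⊓ selmerLocalKerPrimaryTorsion W E p) =
      p ^ n * Nat.card (AddCommGroup.primaryComponent W.sha p) := by
  have hpP : p.Prime := Fact.out
  have hdiv : W.zsmul_geomPoints_surjective := W.zsmul_geomPoints_surjective_holds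
  let bc : W.toAffine.Point →+ (W.baseChange E).toAffine.Point :=
    Affine.Point.baseChange (W' := W) K E
  have hbc : ∀ X, Affine.Point.baseChange (W' := W) K E X = bc X := fun _ => rfl
  have hinj : Function.Injective bc := Affine.Point.map_injective (W' := W) (Algebra.ofId K E)
  obtain ⟨Q, hQ⟩ := hdivP
  rw [hbc] at hQ
  have hndiv' : ∀ Q' : (W.baseChange E).toAffine.Point, p ^ (n + 1) • Q' ≠ p ^ n • Q := fun Q' => by
    rw [hQ]; exact hndiv Q'
  have hu0 : lam (bc P) ≠ 0 := by
    intro h0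
    apply hP
    obtain ⟨m, hm, hmP⟩ := isOfFinAddOrder_iff_nsmul_eq_zero.mp ((hlam _).mp h0)
    refine isOfFinAddOrder_iff_nsmul_eq_zero.mpr ⟨m, hm, hinj ?_⟩
    rw [map_nsmul, map_zero]
    exact hmP
  set S₀ := W.selmerGroupPInfty p ⊓ selmerLocalKerPrimaryTorsion W E p with hS₀
  set πS : S₀ →+ W.galH1 := (primaryH1ToH1 W p).comp S₀.subtype with hπS
  -- (i) the image of `S₀` in `H¹(K, E)` is ALL of `Ш[p^∞]` (core of `StrictSelmerDominatesSha`)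
  have hrange : πS.range = (AddCommGroup.primaryComponent W.sha p).map W.sha.subtype := by
    rw [← map_primaryH1ToH1_selmerGroupPInfty W p hdiv]
    ext x
    constructor
    · rintro ⟨c, rfl⟩
      exact ⟨c, c.2.1, rfl⟩
    · rintro ⟨s, hs, rfl⟩
      obtain ⟨m, a, hstr⟩ := exists_sub_kummerMapLevel_mem_selmerLocalKerPrimaryTorsion W p hdiv E
        lam hlam hlamb P hu0 s (hloc hs)
      have hker : kummerMapLevel W p hdiv m (a • P) ∈ W.selmerGroupPInfty p :=
        ker_primaryH1ToH1_le_selmerGroupPInfty W p (primaryH1ToH1_kummerMapLevel W p hdiv m (a • P))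
      refine ⟨⟨s - kummerMapLevel W p hdiv m (a • P), (W.selmerGroupPInfty p).sub_mem hs hker,
        hstr⟩, ?_⟩
      change primaryH1ToH1 W p (s - kummerMapLevel W p hdiv m (a • P)) = primaryH1ToH1 W p s
      rw [map_sub, primaryH1ToH1_kummerMapLevel, sub_zero]
  have hcardSha : Nat.card (AddCommGroup.primaryComponent W.sha p) = Nat.card πS.range := by
    rw [hrange]
    exact Nat.card_congr ((AddCommGroup.primaryComponent W.sha p).equivMapOfInjective
      W.sha.subtype Subtype.val_injective).toEquiv
  -- (ii) the kernel of `πS` = the STRICT Kummer classes = `{κ_n(a • P)}` ≅ `ℤ/p^n`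
  set φ : ℤ →+ galH1Primary W p := (kummerMapLevel W p hdiv n).comp (zmultiplesHom _ P) with hφdef
  have hφ : ∀ a : ℤ, φ a = kummerMapLevel W p hdiv n (a • P) := fun a => by
    rw [hφdef, AddMonoidHom.comp_apply, zmultiplesHom_apply]
  have hkerφ : φ.ker = AddSubgroup.zmultiples ((p ^ n : ℕ) : ℤ) := by
    ext a
    rw [AddMonoidHom.mem_ker, hφ, AddSubgroup.mem_zmultiples_iff]
    constructor
    · intro h0
      obtain ⟨m, P₀, hP₀⟩ := exists_of_kummerMapLevel_eq_zero W p hdiv n (a • P) h0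
      obtain ⟨k, T, hT, rfl⟩ := hgen P₀
      -- `(p^m a − p^(n+m) k) • P = p^(n+m) • T` is torsion, so the scalar vanishes
      have hc : ((p ^ m : ℕ) * a - (p ^ (n + m) : ℕ) * k : ℤ) • P = p ^ (n + m) • T := by
        rw [sub_smul, mul_smul, mul_smul, natCast_zsmul, natCast_zsmul, hP₀, smul_add]
        abel
      have hc0 := zsmul_eq_zero_of_isOfFinAddOrder hP (hc ▸ hT.nsmul)
      refine ⟨k, ?_⟩
      have h1 : ((p ^ m : ℕ) : ℤ) * a = ((p ^ m : ℕ) : ℤ) * ((p ^ n : ℕ) * k) := by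
        push_cast at hc0 ⊢
        linear_combination hc0
      have hpm : ((p ^ m : ℕ) : ℤ) ≠ 0 := by exact_mod_cast pow_ne_zero m hpP.ne_zero
      rw [mul_left_cancel₀ hpm h1, smul_eq_mul, mul_comm]
    · rintro ⟨k, rfl⟩
      rw [smul_eq_mul, mul_smul, natCast_zsmul, smul_comm, kummerMapLevel_nsmul_self]
  have hrangeφ : φ.range = (πS.ker).map S₀.subtype := by
    ext x
    constructor
    · rintro ⟨a, rfl⟩
      rw [hφ]
      have hker : primaryH1ToH1 W p (kummerMapLevel W p hdiv n (a • P)) = 0 :=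
        primaryH1ToH1_kummerMapLevel W p hdiv n (a • P)
      have hSel : kummerMapLevel W p hdiv n (a • P) ∈ W.selmerGroupPInfty p :=
        ker_primaryH1ToH1_le_selmerGroupPInfty W p hker
      have hstr : kummerMapLevel W p hdiv n (a • P) ∈ selmerLocalKerPrimaryTorsion W E p :=
        kummerMapLevel_mem_selmerLocalKerPrimaryTorsion_of_eq_nsmul W p hdiv E n (a • P) (a • Q)
          (by rw [hbc, map_zsmul, ← hQ, smul_comm])
      exact ⟨⟨kummerMapLevel W p hdiv n (a • P), hSel, hstr⟩, hker, rfl⟩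
    · rintro ⟨c, hc, rfl⟩
      have hc0 : primaryH1ToH1 W p c = 0 := hc
      have hcker : (c : galH1Primary W p) ∈ (kummerMapPInfty W p hdiv).range := by
        rw [range_kummerMapPInfty W p hdiv]
        exact hc0
      obtain ⟨t, ht⟩ := hcker
      obtain ⟨R', N, rfl⟩ := exists_eq_tmul_prufGen W p t
      rw [kummerMapPInfty_tmul_prufGen] at ht
      obtain ⟨k, T, hT, rfl⟩ := hgen R'
      rw [map_add, kummerMapLevel_eq_zero_of_isOfFinAddOrder W p hdiv N hT, add_zero] at ht
      -- the class is strict: `res κ_N(k • P) = 0`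
      have hres : resH1Hom (resGal (K := K) E) (primaryPointsMap W E p)
          (primaryPointsMap_smul W E p) (kummerMapLevel W p hdiv N (k • P)) = 0 := by
        have h2 : (c : galH1Primary W p) ∈ selmerLocalKerPrimaryTorsion W E p := c.2.2
        rw [← ht] at h2
        exact h2
      change (c : galH1Primary W p) ∈ φ.range
      rw [← ht]
      rcases eq_or_ne k 0 with rfl | hk
      · exact ⟨0, by rw [zero_smul, map_zero, map_zero]⟩
      obtain ⟨R, T', hT', hRT⟩ :=
        exists_eq_nsmul_add_of_res_kummerMapLevel_eq_zero W p hdiv E N (k • P) hres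
      rw [hbc, map_zsmul, ← hQ] at hRT
      have hle : N ≤ n + padicValInt p k :=
        le_add_padicValInt_of_zsmul_eq_nsmul_add p lam hlam hnoTors hndiv' hk hT' hRT
      -- `p^(N-n) ∣ k`, so `κ_N(k • P)` has level `n`
      obtain ⟨k₂, hk₂⟩ : (p : ℤ) ^ (N - n) ∣ k :=
        (padicValInt_dvd_iff (N - n) k).mpr (Or.inr (by omega))
      rcases le_or_gt n N with hnN | hNn
      · refine ⟨k₂, ?_⟩
        rw [hφ, hk₂, mul_smul, ← Nat.cast_pow, natCast_zsmul]
        exact (kummerMapLevel_level W p hdiv n (N - n) N (by omega) (k₂ • P)).symm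
      · refine ⟨(p : ℤ) ^ (n - N) * k, ?_⟩
        rw [hφ, mul_smul, ← Nat.cast_pow, natCast_zsmul]
        exact kummerMapLevel_level W p hdiv N (n - N) n (by omega) (k • P)
  have hcardKer : Nat.card πS.ker = p ^ n := by
    have e1 : Nat.card πS.ker = Nat.card φ.range := by
      rw [hrangeφ]
      exact Nat.card_congr (πS.ker.equivMapOfInjective S₀.subtype Subtype.val_injective).toEquiv
    rw [e1, ← Nat.card_congr (QuotientAddGroup.quotientKerEquivRange φ).toEquiv, hkerφ,
      Nat.card_congr (Int.quotientZMultiplesNatEquivZMod (p ^ n)).toEquiv, Nat.card_zmod]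
  -- (iii) counting
  rw [AddSubgroup.card_eq_card_quotient_mul_card_addSubgroup πS.ker,
    Nat.card_congr (QuotientAddGroup.quotientKerEquivRange πS).toEquiv, ← hcardSha, hcardKer,
    mul_comm]

/-! ### §4 (P4♯) over `ℚ`: `Additive.StrictSelmerIndexAt W p` HOLDS, unconditionally -/

/-- **(P4♯) `Additive.StrictSelmerIndexAt W p` HOLDS — unconditionally, for every elliptic curve
`E/ℚ` (any model `W`) and every prime `p`** (cc-typer-6's ELEMENTARY typed input p307042
`QuadraticBranchOddStrictExactControl.lean` §3, discharged): if `P ∈ E(ℚ)` has infinite order and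
generates `E(ℚ)` modulo torsion, `E(ℚ_p)` has no point of order `p`, and the image of `P` in `E(ℚ_p)`
is divisible by `pⁿ` and not by `pⁿ⁺¹`, then `#Sel_str(E/ℚ)[p^∞] = pⁿ · #Ш(E/ℚ)[p^∞]` (`Nat.card`;
`0 = 0` if `Ш[p^∞]` is infinite). §3 fed with `λ : E(ℚ_p) → ℤ_p` from AEC VII.6.3
(`exists_addMonoidHom_padicInt_ker_torsion_pow_mem_range`) and the transport of the Selmer local
condition to `ℚ_[p]` (`selmerGroupPInfty_le_selmerLocalKerPrimary_padic`).
[cite: GreenbergLNM1716, §2 (pp. 62–63)] [cite: KuriharaPollack2007, §1.5 (p. 361)]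
[cite: SilvermanAEC2009, Prop. VII.6.3] -/
theorem strictSelmerIndexAt_holds (W : WeierstrassCurve ℚ) [W.IsElliptic] (p : ℕ) [Fact p.Prime] :
    Additive.StrictSelmerIndexAt W p := by
  intro P n hP hgen htors hdivP hndiv
  obtain ⟨lam, b, hlam, hlamb⟩ :=
    exists_addMonoidHom_padicInt_ker_torsion_pow_mem_range p (W.baseChange ℚ_[p])
  -- (the general form is elaborated with the classical `DecidableEq K`; over `ℚ` the instance
  -- `instDecidableEqRat` is found instead — `convert` bridges the subsingleton instance gap)
  refine card_strictSelmer_eq_pow_mul_card_sha_of_hom W p ℚ_[p] lam hlam hlamb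
    (selmerGroupPInfty_le_selmerLocalKerPrimary_padic W p) htors (P := P) ?_ ?_ hdivP hndiv
  · convert hP
  · intro R
    obtain ⟨k, T, hT, hR⟩ := hgen R
    exact ⟨k, T, by convert hT, by convert hR⟩

/-- With `Ш(E/ℚ)[p^∞]` finite: **`ord_p #Sel_str(E/ℚ)[p^∞] = n + ord_p #Ш(E/ℚ)[p^∞]`** (the form the
(C3_η) consumer uses), now a theorem. [cite: GreenbergLNM1716, §2 (pp. 62–63)] -/
theorem padicValNat_card_strictSelmerPInfty_eq (W : WeierstrassCurve ℚ) [W.IsElliptic] (p : ℕ)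
    [Fact p.Prime] {P : W.toAffine.Point} {n : ℕ} (hP : ¬ IsOfFinAddOrder P)
    (hgen : ∀ R : W.toAffine.Point, ∃ (k : ℤ) (T : W.toAffine.Point),
      IsOfFinAddOrder T ∧ R = k • P + T)
    (htors : ∀ Q : (W.baseChange ℚ_[p]).toAffine.Point, p • Q = 0 → Q = 0)
    (hdiv : ∃ Q : (W.baseChange ℚ_[p]).toAffine.Point, p ^ n • Q = W.toPadicPoint p P)
    (hndiv : ∀ Q : (W.baseChange ℚ_[p]).toAffine.Point, p ^ (n + 1) • Q ≠ W.toPadicPoint p P)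
    [Finite (AddCommGroup.primaryComponent W.sha p)] :
    padicValNat p (Nat.card ↥(strictSelmerPInfty W p)) =
      n + padicValNat p (Nat.card (AddCommGroup.primaryComponent W.sha p)) :=
  (strictSelmerIndexAt_holds W p).padicValNat_card_eq hP hgen htors hdiv hndiv

/-- **Exact `p`-divisibility levels exist.** In an additive group with `λ : G → ℤ_p` vanishing exactly
on torsion, a point `X` of infinite order has an exact level: `∃ n, (∃ Q, pⁿ • Q = X) ∧ ∀ Q, pⁿ⁺¹ • Q ≠ X`
(levels are bounded by `v_p(λ X)`; `Nat.findGreatest`). For `G = E(ℚ_p)` this is the finiteness of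
the `p`-divisibility level `ν` of a non-torsion point (AEC VII.6.3). [cite: SilvermanAEC2009, Prop. VII.6.3] -/
theorem exists_level_of_not_isOfFinAddOrder {G : Type*} [AddCommGroup G] (p : ℕ) [Fact p.Prime]
    (lam : G →+ ℤ_[p]) (hlam : ∀ X, lam X = 0 ↔ IsOfFinAddOrder X) {X : G}
    (hX : ¬ IsOfFinAddOrder X) :
    ∃ n : ℕ, (∃ Q : G, p ^ n • Q = X) ∧ ∀ Q : G, p ^ (n + 1) • Q ≠ X := by
  have hX0 : lam X ≠ 0 := fun h => hX ((hlam X).mp h)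
  have hbd : ∀ (m : ℕ) (Q : G), p ^ m • Q = X → m ≤ (lam X).valuation := by
    intro m Q hQ
    have h1 : lam X = (p : ℤ_[p]) ^ m * lam Q := by
      rw [← hQ, map_nsmul, nsmul_eq_mul, Nat.cast_pow]
    have hQ0 : lam Q ≠ 0 := by
      intro h0; rw [h0, mul_zero] at h1; exact hX0 h1
    rw [h1, PadicInt.valuation_p_pow_mul m _ hQ0]
    exact Nat.le_add_right m _
  refine ⟨Nat.findGreatest (fun m => ∃ Q : G, p ^ m • Q = X) (lam X).valuation,
    Nat.findGreatest_spec (P := fun m => ∃ Q : G, p ^ m • Q = X) (Nat.zero_le _)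
      ⟨X, by rw [pow_zero, one_smul]⟩, fun Q hQ => ?_⟩
  have hle := hbd _ Q hQ
  exact Nat.findGreatest_is_greatest (P := fun m => ∃ Q : G, p ^ m • Q = X) (Nat.lt_succ_self _)
    hle ⟨Q, hQ⟩

/-- **Hypothesis-light corollary: for EVERY `E/ℚ` of Mordell–Weil rank one and every prime `p` with
`E(ℚ_p)[p] = 0` there is `n` (the `p`-divisibility level in `E(ℚ_p)` of a generator modulo torsion)
with `#Sel_str(E/ℚ)[p^∞] = pⁿ · #Ш(E/ℚ)[p^∞]`.** The generator exists by Mordell–Weil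
(`exists_generator_of_mordellWeilRank_eq_one`), its level by `exists_level_of_not_isOfFinAddOrder`.
[cite: GreenbergLNM1716, §2 (pp. 62–63)] [cite: SilvermanAEC2009, Prop. VII.6.3 and Thm. VIII.6.7] -/
theorem exists_card_strictSelmerPInfty_eq_pow_mul (W : WeierstrassCurve ℚ) [W.IsElliptic] (p : ℕ)
    [Fact p.Prime] (hrank : W.mordellWeilRank = 1)
    (htors : ∀ Q : (W.baseChange ℚ_[p]).toAffine.Point, p • Q = 0 → Q = 0) :
    ∃ n : ℕ, Nat.card ↥(strictSelmerPInfty W p) =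
      p ^ n * Nat.card (AddCommGroup.primaryComponent W.sha p) := by
  obtain ⟨P, hP, hgen⟩ := exists_generator_of_mordellWeilRank_eq_one W hrank
  obtain ⟨lam, hlam⟩ := exists_addMonoidHom_padicInt_apply_eq_zero_iff p (W.baseChange ℚ_[p])
  have hinj : Function.Injective (W.toPadicPoint p) :=
    Affine.Point.map_injective (W' := W) (Algebra.ofId ℚ ℚ_[p])
  -- (`hP`, `hgen` carry the classical `DecidableEq ℚ` of the general lemma; `convert` re-instances)
  have hP' : ¬ IsOfFinAddOrder P := by convert hP
  have hPp : ¬ IsOfFinAddOrder (W.toPadicPoint p P) := by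
    intro h
    apply hP'
    obtain ⟨m, hm, hmP⟩ := isOfFinAddOrder_iff_nsmul_eq_zero.mp h
    refine isOfFinAddOrder_iff_nsmul_eq_zero.mpr ⟨m, hm, hinj ?_⟩
    rw [map_nsmul, map_zero]
    exact hmP
  obtain ⟨n, hdiv, hndiv⟩ := exists_level_of_not_isOfFinAddOrder p lam hlam hPp
  refine ⟨n, strictSelmerIndexAt_holds W p P n hP' (fun R => ?_) htors hdiv hndiv⟩
  obtain ⟨a, t, ht, hR⟩ := hgen R
  exact ⟨a, t, by convert ht, by convert hR⟩

end Summit.BirchSwinnertonDyer.Rank1Residual.Additive.StrictSha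

/-! ### §5 The (C1_η) ∧ (C2_η-GZ) ∧ (C3_η) consumer WITHOUT the index input -/

namespace Summit.BirchSwinnertonDyer.Rank1Residual.Additive

open scoped MatrixGroups ModularForm

open CongruenceSubgroup Literature.NumberTheory.EllipticCurves.ModularForms
  Literature.NumberTheory.EllipticCurves.Kobayashi2003
  Literature.NumberTheory.EllipticCurves.Rank1Residual
  Literature.NumberTheory.EllipticCurves.Rank1Residual.Typed

section Consumers

variable (W : WeierstrassCurve ℚ) [W.IsElliptic] [W.IsGloballyMinimal] (p : ℕ) [Fact p.Prime]
  {V : WeierstrassCurve ℚ} [V.IsElliptic] [V.IsGloballyMinimal] {C : VariableChange ℚ}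
  {N : ℕ} [NeZero N] {f : CuspForm (Gamma0 N) 2} {ϖ : ℚ} {L : IwasawaAlgebra p}
  {P : W.toAffine.Point} {n : ℕ}

/-- **END-TO-END with ONE typed input fewer (PROVED over the typed inputs; CONDITIONAL on them;
nothing booked): (C1_η) ∧ (C2_η-GZ) ∧ (C3_η) at a pair `(W, p)` carrying the data, of analytic rank
one ⟹ Miller's `BSD(W, p)`** — cc-typer-6's
`bsdp_of_quadraticBranchPAdicGrossZagierValuation_of_exactControl` (p307042 §4) with its hypothesis
`hidx : StrictSelmerIndexAt W p` DISCHARGED by `StrictSha.strictSelmerIndexAt_holds`. The remaining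
inputs (C1_η) `QuadraticBranchPlusMainConjectureAt V p` (conjecture in print), (C2_η-GZ)
`QuadraticBranchMinusLeadingValuationAt W p 0` (OUR conjecture, EVIDENCE-labelled) and (C3_η)
`QuadraticBranchOddStrictExactControlOfPlusMCAt W p` (MISSING INPUT) are typed `@[conjecture]`s,
none a theorem of the published record; the classes served (O10-PS, O7-ss ∩ `e = 2`, O5a) stay OPEN /
CONSTRUCTION-SHAPED; no label / mark / count moves. [cite: Miller2011LMS, §1 and Def. 1.1]
[cite: Kobayashi2003, §4 (p. 8), Thm. 7.4 (p. 13), Thm. 9.3 (p. 26)]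
[cite: GreenbergLNM1716, §2 (pp. 62–63)] -/
theorem bsdp_of_quadraticBranchPAdicGrossZagierValuation_of_exactControl_index
    (hmod : hasEntireLFunction_rat) (hGZ : GrossZagier1986_thm_I_7_3)
    (hGZK : rank_eq_analyticRank_of_analyticRank_le_one)
    (h2 : QuadraticBranchMinusLeadingValuationAt W p 0)
    (h3 : QuadraticBranchOddStrictExactControlOfPlusMCAt W p)
    (hp : 5 ≤ p) (hC : C • W.quadraticTwist ((-1) ^ (p / 2) * p) = V)
    (hgood : V.HasGoodReductionAtPrime p) (hap : V.frobeniusTrace p = 0)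
    (h1 : QuadraticBranchPlusMainConjectureAt V p) (hf : IsNewformOf V f)
    (hϖ : if Even (p / 2) then (ϖ : ℝ) * V.realPeriodRat = plusPeriod f
        else (ϖ : ℝ) * V.imaginaryPeriodRat = minusPeriod f)
    (hL : IsQuadraticBranchMinusLFunction f p ϖ L)
    (htors : ∀ Q : (W.baseChange ℚ_[p]).toAffine.Point, p • Q = 0 → Q = 0)
    (hP : ¬ IsOfFinAddOrder P)
    (hgen : ∀ R : W.toAffine.Point, ∃ (k : ℤ) (T : W.toAffine.Point),
      IsOfFinAddOrder T ∧ R = k • P + T)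
    (hdiv : ∃ Q : (W.baseChange ℚ_[p]).toAffine.Point, p ^ n • Q = W.toPadicPoint p P)
    (hndiv : ∀ Q : (W.baseChange ℚ_[p]).toAffine.Point, p ^ (n + 1) • Q ≠ W.toPadicPoint p P)
    (hr : W.analyticRank = 1) : BSDp W p :=
  bsdp_of_quadraticBranchPAdicGrossZagierValuation_of_exactControl W p hmod hGZ hGZK h2 h3
    (StrictSha.strictSelmerIndexAt_holds W p) hp hC hgood hap h1 hf hϖ hL htors hP hgen hdiv hndiv hr

/-- … hence **`PPart W p`** and the typed output `MissingPPartAt W p`, again WITHOUT the index input.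
CONDITIONAL on the typed inputs (C1_η), (C2_η-GZ), (C3_η); nothing booked.
[cite: Miller2011LMS, §1 and Def. 1.1] [cite: GreenbergLNM1716, §2 (pp. 62–63)] -/
theorem pPart_of_quadraticBranchPAdicGrossZagierValuation_of_exactControl_index
    (hmod : hasEntireLFunction_rat) (hGZ : GrossZagier1986_thm_I_7_3)
    (hGZK : rank_eq_analyticRank_of_analyticRank_le_one)
    (h2 : QuadraticBranchMinusLeadingValuationAt W p 0)
    (h3 : QuadraticBranchOddStrictExactControlOfPlusMCAt W p)
    (hp : 5 ≤ p) (hC : C • W.quadraticTwist ((-1) ^ (p / 2) * p) = V)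
    (hgood : V.HasGoodReductionAtPrime p) (hap : V.frobeniusTrace p = 0)
    (h1 : QuadraticBranchPlusMainConjectureAt V p) (hf : IsNewformOf V f)
    (hϖ : if Even (p / 2) then (ϖ : ℝ) * V.realPeriodRat = plusPeriod f
        else (ϖ : ℝ) * V.imaginaryPeriodRat = minusPeriod f)
    (hL : IsQuadraticBranchMinusLFunction f p ϖ L)
    (htors : ∀ Q : (W.baseChange ℚ_[p]).toAffine.Point, p • Q = 0 → Q = 0)
    (hP : ¬ IsOfFinAddOrder P)
    (hgen : ∀ R : W.toAffine.Point, ∃ (k : ℤ) (T : W.toAffine.Point),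
      IsOfFinAddOrder T ∧ R = k • P + T)
    (hdiv : ∃ Q : (W.baseChange ℚ_[p]).toAffine.Point, p ^ n • Q = W.toPadicPoint p P)
    (hndiv : ∀ Q : (W.baseChange ℚ_[p]).toAffine.Point, p ^ (n + 1) • Q ≠ W.toPadicPoint p P)
    (hr : W.analyticRank = 1) : Rank1Residual.PPart W p ∧ MissingPPartAt W p :=
  pPart_of_quadraticBranchPAdicGrossZagierValuation_of_exactControl W p hmod hGZ hGZK h2 h3
    (StrictSha.strictSelmerIndexAt_holds W p) hp hC hgood hap h1 hf hϖ hL htors hP hgen hdiv hndiv hr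

end Consumers

end Summit.BirchSwinnertonDyer.Rank1Residual.Additive

end
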